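/-
Copyright (c) 2026 the pub-hodgecm-mathlib formalisation cell (harness21).  Prover seat hodgecm-mathlib-K2Liu-p13 (g3), Track B «K2-LIT»,
#184♮ = hLiu418 = `stmt-HodgeConjecture-24832`; ROAD Φ (RULING «M-156n»), consumer sheet fa2b1e3a29709f09 row G6-fin — letter (WCHAR) of
★ `K2LiuIntertwiningDeltaEquivariance.isSiegelDeltaSection_intertwiningDelta` (LEAD F0P6-plan (g14) BATCH #30 ∕ #32 (2); K2E5-plan (g7) (C) (F4));
census `K2/K2Liu-p13/g3/CENSUS-G6fin-Phi8FacePackaging.K2Liu-p13-g3.md` 065e2d080ef468d9.  THEOREMS ONLY (no `def`, no `instance`, no named-fact hypothesis, no `sorry`).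
-/
import Summits.HodgeConjecture.HodgeConjecture.Theorems.K2LiuIntertwiningDeltaLeviLaw
import Literature.NumberTheory.Automorphic.GodementHeightFloor                              -- ★ `ideleNorm_unitsMap_adeleConj`
import Literature.NumberTheory.Automorphic.AdelicUnitaryGroupDatum                           -- ★ `conjAdele_complexConj`
import Literature.NumberTheory.Automorphic.IdeleClassGroup                                   -- ★ `coe_ideleNorm`
import HarnessLib

/-!
# Crux `HLiu418`, ROAD Φ, organ Φ8 (sheet row G6-fin): THE WEYL-CONJUGATE CHARACTER LAW ON THE SIEGEL LEVI —
# `δ_{χ,s}(w_Δ · Λ g · w_Δ) = χ′(det g) · |det g|_𝔸^{−(s + n∕2)}`, `χ′ = (χ ∘ c)⁻¹`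

Cell `hodgecm-mathlib`, crux item hLiu418 = `stmt-HodgeConjecture-24832` (helper lane, count-neutral).  GENERIC `n`, doubled frame `H(𝔸) = HA L e dV hdV dW hdW`;
the Levi homomorphism `Λ : GL_n(𝔸_L) →* H(𝔸)` BY VALUE (`hΛ : blk (Λ g) = R·diag(g, g♯)·R⁻¹`, `g♯ = T⁻¹ (c g)⁻ᵀ T`, as in ★ `K2LiuSiegelRationalLeviDecomposition`).
The Weyl element swaps the two Levi blocks: `blk (w_Δ Λg w_Δ) = R·diag(g♯, g)·R⁻¹` (★ `blk_weylDelta_mul_mul_weylDelta_of_blk_eq_levi`), so the element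
`w_Δ Λg w_Δ ∈ P_Δ(𝔸)` acts on `Δ` by `g♯`:  `det_Δ(w_Δ Λg w_Δ) = det g♯ = c(det g)⁻¹` (§1); the idele norm is `c`-invariant (★ `ideleNorm_unitsMap_adeleConj`),
so `modDelta(w_Δ Λg w_Δ) = modDelta(Λ g)⁻¹ = |det g|_𝔸^{−1∕2}` (§2), and `χ(det_Δ(w_Δ Λg w_Δ)) = χ(c(det g))⁻¹ = χ′(det g)` for every `χ′` with
`χ′(u) = χ(c u)⁻¹` (BY VALUE `hχ'`; for the conjugate-symplectic character of the K2_Liu frame `χ′ = χ`).  Hence (§3)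
**`siegelDeltaCharacter_weylDelta_conj_levi`**: `δ_{χ,s}(w_Δ Λg w_Δ) = χ′(det_Δ Λg) · modDelta(Λ g)^{−(2s+n)}` — the binder `hwchar` of ★
`K2LiuIntertwiningDeltaEquivariance.isSiegelDeltaSection_intertwiningDelta` ∕ `intertwiningDelta_family_equivariant`, VERBATIM (local twin: ★
`K2LiuLocalIntertwiningProperty.chiDet_weylDelta_conj` ∕ `absDetDelta_weylDelta_conj`).
Sources: [HarrisKudlaSweet1996, §1 (1.11)–(1.15), §6 (6.14) (`M(s) : I_n(s, χ) → I_n(−s, (χ ∘ c)⁻¹)`)]; [MoeglinWaldspurger1995, II.1.6]; [Casselman1980, §3].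
HONEST LABEL.  Helper lemmas, count-neutral; `HC_CM` is proved only modulo the 7 printed citations (2 remaining named inputs:
hLiu418 = `stmt-HodgeConjecture-24832`, h413 = `stmt-HodgeConjecture-24833`) until rung 0 closes.
-/

set_option autoImplicit false
set_option linter.dupNamespace false -- the mandated namespace repeats `HodgeConjecture.HodgeConjecture`

noncomputable section

open scoped Matrix NNReal
open NumberField IsDedekindDomain

namespace Summit.HodgeConjecture.HodgeConjecture.Cruxes.HLiu418.K2LiuSiegelWeylCharacterLaw

open Literature.NumberTheory.GelbartRogawski1991.AdaptedBlocks
open Literature.NumberTheory.Automorphic Literature.NumberTheory.Automorphic.UnitaryGroup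
open Literature.NumberTheory.GelbartRogawski1991 Literature.NumberTheory.GelbartRogawski1991.GRConstruction
open Literature.NumberTheory.K2Lit.SiegelDoubled Literature.NumberTheory.GaloisRepresentations
open UnitaryDualPair
open Summit.HodgeConjecture.HodgeConjecture.Cruxes.HLiu418.K2LiuSiegelDoubledLeviMatrix
open Summit.HodgeConjecture.HodgeConjecture.Cruxes.HLiu418.K2LiuSiegelRationalLeviDecomposition
open Summit.HodgeConjecture.HodgeConjecture.Cruxes.HLiu418.K2LiuIntertwiningCentralRayEigen (blk_weylDelta_mul_mul_weylDelta_of_blk_eq_levi)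

variable (L : Type) [Field L] [NumberField L] [IsCMField L]
variable {N M n : ℕ} (e : Fin N × Fin M ≃ Fin n)
  (dV : Fin N → L) (hdV : ∀ i, IsCMField.complexConj L (dV i) = dV i)
  (dW : Fin M → L) (hdW : ∀ i, IsCMField.complexConj L (dW i) = dW i)

variable (Λ : GL (Fin n) (AdeleRing (𝓞 L) L) →* HA L e dV hdV dW hdW)
  (hΛ : ∀ g : GL (Fin n) (AdeleRing (𝓞 L) L), blk L e dV hdV dW hdW (Λ g) =
    cayR (AdeleRing (𝓞 L) L) (Fin n) * Matrix.fromBlocks (g : Matrix (Fin n) (Fin n) (AdeleRing (𝓞 L) L)) 0 0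
      (((gramR L e dV hdV dW hdW).map ((algebraMap L (AdeleRing (𝓞 L) L)).comp (algebraMap (Fp L) L)))⁻¹ *
        (((g⁻¹ : GL (Fin n) (AdeleRing (𝓞 L) L)) : Matrix (Fin n) (Fin n) (AdeleRing (𝓞 L) L)).map
          (conjAdele (Fp L) L (IsCMField.complexConj L)))ᵀ *
        (gramR L e dV hdV dW hdW).map ((algebraMap L (AdeleRing (𝓞 L) L)).comp (algebraMap (Fp L) L))) *
      cayRinv (AdeleRing (𝓞 L) L) (Fin n))

/-! ## §1 The `Δ`-block and the determinant of `w_Δ Λg w_Δ` -/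

include hΛ in
/-- `w_Δ Λg w_Δ ∈ P_Δ(𝔸)` (its blocks are `R·diag(g♯, g)·R⁻¹`). [cite: HarrisKudlaSweet1996, §1 (1.11)] -/
theorem isSiegelDelta_weylDelta_conj_levi (g : GL (Fin n) (AdeleRing (𝓞 L) L)) :
    IsSiegelDelta L e dV hdV dW hdW (weylDelta L e dV hdV dW hdW * Λ g * weylDelta L e dV hdV dW hdW) :=
  isSiegelDelta_of_blk_eq_levi L e dV hdV dW hdW (blk_weylDelta_mul_mul_weylDelta_of_blk_eq_levi L e dV hdV dW hdW (hΛ g))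

include hΛ in
/-- **`det_Δ(w_Δ Λg w_Δ) = c(det g⁻¹)`**: the `Δ`-block of `w_Δ Λg w_Δ` is `g♯ = T⁻¹ (c g⁻¹)ᵀ T` (★ `deltaBlock_of_blk_eq_levi`), whose determinant is
`det(c g⁻¹) = c(det g⁻¹)` (`det T⁻¹ · det T = 1`). [cite: HarrisKudlaSweet1996, §1 (1.15)] -/
theorem detDelta_weylDelta_conj_levi (hdV0 : ∀ i, dV i ≠ 0) (hdW0 : ∀ i, dW i ≠ 0) (g : GL (Fin n) (AdeleRing (𝓞 L) L)) :
    detDelta L e dV hdV dW hdW (weylDelta L e dV hdV dW hdW * Λ g * weylDelta L e dV hdV dW hdW) =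
      conjAdele (Fp L) L (IsCMField.complexConj L)
        (Matrix.det (((g⁻¹ : GL (Fin n) (AdeleRing (𝓞 L) L)) : Matrix (Fin n) (Fin n) (AdeleRing (𝓞 L) L)))) := by
  have hT := isUnit_det_gramRA L e dV hdV dW hdW hdV0 hdW0
  unfold detDelta
  rw [deltaBlock_of_blk_eq_levi L e dV hdV dW hdW (blk_weylDelta_mul_mul_weylDelta_of_blk_eq_levi L e dV hdV dW hdW (hΛ g)),
    Matrix.det_mul, Matrix.det_mul, mul_right_comm, ← Matrix.det_mul, Matrix.nonsing_inv_mul _ hT, Matrix.det_one, one_mul, Matrix.det_transpose,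
    ← RingHom.mapMatrix_apply, ← RingHom.map_det]

include hΛ in
/-- the `Δ`-determinant of `w_Δ Λg w_Δ` as a unit: `c • (det g)⁻¹`. [cite: HarrisKudlaSweet1996, §1 (1.15)] -/
theorem unit_detDelta_weylDelta_conj_levi (hdV0 : ∀ i, dV i ≠ 0) (hdW0 : ∀ i, dW i ≠ 0) (g : GL (Fin n) (AdeleRing (𝓞 L) L))
    (hu : IsUnit (detDelta L e dV hdV dW hdW (weylDelta L e dV hdV dW hdW * Λ g * weylDelta L e dV hdV dW hdW))) :
    hu.unit = Units.map (conjAdele (Fp L) L (IsCMField.complexConj L) : AdeleRing (𝓞 L) L →* AdeleRing (𝓞 L) L)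
      (Matrix.GeneralLinearGroup.det g)⁻¹ := by
  apply Units.ext
  rw [IsUnit.unit_spec, detDelta_weylDelta_conj_levi L e dV hdV dW hdW Λ hΛ hdV0 hdW0 g, Units.coe_map, MonoidHom.coe_coe, ← map_inv,
    Matrix.GeneralLinearGroup.val_det_apply]

include hΛ in
/-- the `Δ`-determinant of `Λ g` as a unit: `det g`. [cite: HarrisKudlaSweet1996, §1 (1.11)] -/
theorem unit_detDelta_levi (g : GL (Fin n) (AdeleRing (𝓞 L) L)) (hu : IsUnit (detDelta L e dV hdV dW hdW (Λ g))) :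
    hu.unit = Matrix.GeneralLinearGroup.det g := by
  apply Units.ext
  rw [IsUnit.unit_spec, Matrix.GeneralLinearGroup.val_det_apply]
  unfold detDelta
  rw [deltaBlock_levi_apply L e dV hdV dW hdW Λ hΛ g]

/-! ## §2 The modulus: `modDelta(w_Δ Λg w_Δ) = modDelta(Λ g)⁻¹` -/

include hΛ in
/-- `modDelta(Λ g) = |det g|_𝔸^{1∕2}`. [cite: HarrisKudlaSweet1996, §1 (1.11)] -/
theorem modDelta_levi_eq_sqrt (g : GL (Fin n) (AdeleRing (𝓞 L) L)) :
    modDelta L e dV hdV dW hdW (Λ g) = Real.sqrt (ideleNorm (Matrix.GeneralLinearGroup.det g)) := by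
  have hu : IsUnit (detDelta L e dV hdV dW hdW (Λ g)) :=
    isUnit_detDelta_of_isSiegelDelta L e dV hdV dW hdW _ (isSiegelDelta_levi_apply L e dV hdV dW hdW Λ hΛ g)
  unfold modDelta
  rw [dif_pos hu, unit_detDelta_levi L e dV hdV dW hdW Λ hΛ g hu]

include hΛ in
/-- `modDelta(w_Δ Λg w_Δ) = |c(det g)⁻¹|_𝔸^{1∕2}`. [cite: HarrisKudlaSweet1996, §1 (1.15)] -/
theorem modDelta_weylDelta_conj_levi_eq_sqrt (hdV0 : ∀ i, dV i ≠ 0) (hdW0 : ∀ i, dW i ≠ 0) (g : GL (Fin n) (AdeleRing (𝓞 L) L)) :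
    modDelta L e dV hdV dW hdW (weylDelta L e dV hdV dW hdW * Λ g * weylDelta L e dV hdV dW hdW) =
      Real.sqrt (ideleNorm (Units.map (conjAdele (Fp L) L (IsCMField.complexConj L) : AdeleRing (𝓞 L) L →* AdeleRing (𝓞 L) L)
        (Matrix.GeneralLinearGroup.det g)⁻¹)) := by
  have hu : IsUnit (detDelta L e dV hdV dW hdW (weylDelta L e dV hdV dW hdW * Λ g * weylDelta L e dV hdV dW hdW)) :=
    isUnit_detDelta_of_isSiegelDelta L e dV hdV dW hdW _ (isSiegelDelta_weylDelta_conj_levi L e dV hdV dW hdW Λ hΛ g)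
  unfold modDelta
  rw [dif_pos hu, unit_detDelta_weylDelta_conj_levi L e dV hdV dW hdW Λ hΛ hdV0 hdW0 g hu]

omit [IsCMField L] in
/-- `|c u|_𝔸 · … `: the idele norm of `L` is invariant under complex conjugation and multiplicative, so `|c(u⁻¹)|_𝔸 · |u|_𝔸 = 1`.
[cite: CasselsFrohlichANT1967, Ch. VII §1.1] -/
theorem ideleNorm_conj_inv_mul [IsCMField L] (u : (AdeleRing (𝓞 L) L)ˣ) :
    ideleNorm (Units.map (conjAdele (Fp L) L (IsCMField.complexConj L) : AdeleRing (𝓞 L) L →* AdeleRing (𝓞 L) L) u⁻¹) * ideleNorm u = 1 := by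
  rw [← coe_ideleNorm, ← coe_ideleNorm, ← NNReal.coe_mul, conjAdele_complexConj, Godement.ideleNorm_unitsMap_adeleConj, ← map_mul, inv_mul_cancel,
    map_one, NNReal.coe_one]

include hΛ in
/-- **`modDelta(w_Δ Λg w_Δ) · modDelta(Λ g) = 1`.** [cite: HarrisKudlaSweet1996, §1 (1.15)] [cite: MoeglinWaldspurger1995, II.1.6] -/
theorem modDelta_weylDelta_conj_levi_mul (hdV0 : ∀ i, dV i ≠ 0) (hdW0 : ∀ i, dW i ≠ 0) (g : GL (Fin n) (AdeleRing (𝓞 L) L)) :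
    modDelta L e dV hdV dW hdW (weylDelta L e dV hdV dW hdW * Λ g * weylDelta L e dV hdV dW hdW) * modDelta L e dV hdV dW hdW (Λ g) = 1 := by
  have h0 : ∀ v : (AdeleRing (𝓞 L) L)ˣ, 0 ≤ ideleNorm v := fun v => by rw [← coe_ideleNorm]; exact NNReal.coe_nonneg _
  rw [modDelta_weylDelta_conj_levi_eq_sqrt L e dV hdV dW hdW Λ hΛ hdV0 hdW0 g, modDelta_levi_eq_sqrt L e dV hdV dW hdW Λ hΛ g,
    ← Real.sqrt_mul (h0 _), ideleNorm_conj_inv_mul, Real.sqrt_one]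

include hΛ in
/-- **`modDelta(w_Δ Λg w_Δ) = modDelta(Λ g)⁻¹`.** [cite: HarrisKudlaSweet1996, §1 (1.15)] [cite: MoeglinWaldspurger1995, II.1.6] -/
theorem modDelta_weylDelta_conj_levi (hdV0 : ∀ i, dV i ≠ 0) (hdW0 : ∀ i, dW i ≠ 0) (g : GL (Fin n) (AdeleRing (𝓞 L) L)) :
    modDelta L e dV hdV dW hdW (weylDelta L e dV hdV dW hdW * Λ g * weylDelta L e dV hdV dW hdW) = (modDelta L e dV hdV dW hdW (Λ g))⁻¹ :=
  eq_inv_of_mul_eq_one_left (modDelta_weylDelta_conj_levi_mul L e dV hdV dW hdW Λ hΛ hdV0 hdW0 g)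

/-! ## §3 The character: `χ(det_Δ(w_Δ Λg w_Δ)) = χ′(det g)` and the law -/

include hΛ in
/-- **`χ(det_Δ(w_Δ Λg w_Δ)) = χ′(det_Δ Λg)`** for every `χ′` with `χ′(u) = χ(c u)⁻¹` (`χ′ = (χ ∘ c)⁻¹`). [cite: HarrisKudlaSweet1996, §1 (1.15), §6 (6.14)] -/
theorem chiDet_weylDelta_conj_levi (hdV0 : ∀ i, dV i ≠ 0) (hdW0 : ∀ i, dW i ≠ 0) (χ χ' : HeckeCharacter L)
    (hχ' : ∀ u : (AdeleRing (𝓞 L) L)ˣ,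
      χ' u = (χ (Units.map (conjAdele (Fp L) L (IsCMField.complexConj L) : AdeleRing (𝓞 L) L →* AdeleRing (𝓞 L) L) u))⁻¹)
    (g : GL (Fin n) (AdeleRing (𝓞 L) L)) :
    chiDet L e dV hdV dW hdW χ (weylDelta L e dV hdV dW hdW * Λ g * weylDelta L e dV hdV dW hdW) = chiDet L e dV hdV dW hdW χ' (Λ g) := by
  have hu : IsUnit (detDelta L e dV hdV dW hdW (weylDelta L e dV hdV dW hdW * Λ g * weylDelta L e dV hdV dW hdW)) :=
    isUnit_detDelta_of_isSiegelDelta L e dV hdV dW hdW _ (isSiegelDelta_weylDelta_conj_levi L e dV hdV dW hdW Λ hΛ g)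
  have hu' : IsUnit (detDelta L e dV hdV dW hdW (Λ g)) :=
    isUnit_detDelta_of_isSiegelDelta L e dV hdV dW hdW _ (isSiegelDelta_levi_apply L e dV hdV dW hdW Λ hΛ g)
  unfold chiDet
  rw [dif_pos hu, dif_pos hu', unit_detDelta_weylDelta_conj_levi L e dV hdV dW hdW Λ hΛ hdV0 hdW0 g hu, unit_detDelta_levi L e dV hdV dW hdW Λ hΛ g hu',
    map_inv, map_inv, hχ']

/-- `(x⁻¹)^z = x^{−z}` for a real `x > 0` (complex powers). [folklore] -/
theorem ofReal_inv_cpow {x : ℝ} (hx : 0 < x) (z : ℂ) : (((x⁻¹ : ℝ) : ℂ)) ^ z = (x : ℂ) ^ (-z) := by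
  have harg : (x : ℂ).arg ≠ Real.pi := by
    rw [Complex.arg_ofReal_of_nonneg hx.le]; exact Real.pi_ne_zero.symm
  rw [Complex.ofReal_inv, Complex.inv_cpow _ _ harg, Complex.cpow_neg]

include hΛ in
/-- **THE WEYL-CONJUGATE CHARACTER LAW** — the binder `hwchar` of ★ `K2LiuIntertwiningDeltaEquivariance.isSiegelDeltaSection_intertwiningDelta`, VERBATIM:
`δ_{χ,s}(w_Δ Λg w_Δ) = χ′(det_Δ Λg) · modDelta(Λ g)^{−(2s+n)}` for every `g ∈ GL_n(𝔸_L)` and every `χ′` with `χ′(u) = χ(c u)⁻¹`.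
[cite: HarrisKudlaSweet1996, §1 (1.15), §6 (6.14)] [cite: MoeglinWaldspurger1995, II.1.6] [cite: Casselman1980, §3] -/
theorem siegelDeltaCharacter_weylDelta_conj_levi (hdV0 : ∀ i, dV i ≠ 0) (hdW0 : ∀ i, dW i ≠ 0) (χ χ' : HeckeCharacter L)
    (hχ' : ∀ u : (AdeleRing (𝓞 L) L)ˣ,
      χ' u = (χ (Units.map (conjAdele (Fp L) L (IsCMField.complexConj L) : AdeleRing (𝓞 L) L →* AdeleRing (𝓞 L) L) u))⁻¹)
    (s : ℂ) (g : GL (Fin n) (AdeleRing (𝓞 L) L)) :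
    siegelDeltaCharacter L e dV hdV dW hdW χ s (weylDelta L e dV hdV dW hdW * Λ g * weylDelta L e dV hdV dW hdW) =
      ((chiDet L e dV hdV dW hdW χ' (Λ g) : ℂˣ) : ℂ) * ((modDelta L e dV hdV dW hdW (Λ g) : ℂ) ^ (-(2 * s + (n : ℂ)))) := by
  unfold siegelDeltaCharacter
  rw [chiDet_weylDelta_conj_levi L e dV hdV dW hdW Λ hΛ hdV0 hdW0 χ χ' hχ' g, modDelta_weylDelta_conj_levi L e dV hdV dW hdW Λ hΛ hdV0 hdW0 g,
    ofReal_inv_cpow (modDelta_pos L e dV hdV dW hdW (Λ g))]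

/-- the family form: `hwchar` on any half-plane `{c < re}` (it holds for every `s`). [cite: HarrisKudlaSweet1996, §1 (1.15)] -/
theorem siegelDeltaCharacter_weylDelta_conj_levi_family (hdV0 : ∀ i, dV i ≠ 0) (hdW0 : ∀ i, dW i ≠ 0) (χ χ' : HeckeCharacter L)
    (hΛ' : ∀ g : GL (Fin n) (AdeleRing (𝓞 L) L), blk L e dV hdV dW hdW (Λ g) =
      cayR (AdeleRing (𝓞 L) L) (Fin n) * Matrix.fromBlocks (g : Matrix (Fin n) (Fin n) (AdeleRing (𝓞 L) L)) 0 0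
        (((gramR L e dV hdV dW hdW).map ((algebraMap L (AdeleRing (𝓞 L) L)).comp (algebraMap (Fp L) L)))⁻¹ *
          (((g⁻¹ : GL (Fin n) (AdeleRing (𝓞 L) L)) : Matrix (Fin n) (Fin n) (AdeleRing (𝓞 L) L)).map
            (conjAdele (Fp L) L (IsCMField.complexConj L)))ᵀ *
          (gramR L e dV hdV dW hdW).map ((algebraMap L (AdeleRing (𝓞 L) L)).comp (algebraMap (Fp L) L))) *
        cayRinv (AdeleRing (𝓞 L) L) (Fin n))
    (hχ' : ∀ u : (AdeleRing (𝓞 L) L)ˣ,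
      χ' u = (χ (Units.map (conjAdele (Fp L) L (IsCMField.complexConj L) : AdeleRing (𝓞 L) L →* AdeleRing (𝓞 L) L) u))⁻¹)
    (c : ℝ) :
    ∀ s : ℂ, c < s.re → ∀ g : GL (Fin n) (AdeleRing (𝓞 L) L),
      siegelDeltaCharacter L e dV hdV dW hdW χ s (weylDelta L e dV hdV dW hdW * Λ g * weylDelta L e dV hdV dW hdW) =
        ((chiDet L e dV hdV dW hdW χ' (Λ g) : ℂˣ) : ℂ) * ((modDelta L e dV hdV dW hdW (Λ g) : ℂ) ^ (-(2 * s + (n : ℂ)))) :=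
  fun s _ g => siegelDeltaCharacter_weylDelta_conj_levi L e dV hdV dW hdW Λ hΛ' hdV0 hdW0 χ χ' hχ' s g

end Summit.HodgeConjecture.HodgeConjecture.Cruxes.HLiu418.K2LiuSiegelWeylCharacterLaw

end
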